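import Literature.Geometry.Riemannian.LinearHeatWeakRegularity
import Literature.Geometry.Riemannian.NashEntropy
import Literature.Geometry.Riemannian.LinearHeatForcedExistence
import Literature.Geometry.Manifold.TimeDerivativeSmooth
import Mathlib.Geometry.Manifold.BumpFunction
import Mathlib.Analysis.Calculus.Deriv.Support
import Mathlib.MeasureTheory.Integral.IntegralEqImproper
import HarnessLib

/-!
# Smooth very weak solutions of a linear heat-type equation are classical solutions

The converse companion of the hypoellipticity theorem
`exists_contMDiffOn_ae_eq_of_linearHeat_veryWeak` (`LinearHeatWeakRegularity.lean`): for a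
`C^∞` family of Riemannian metrics `h` on a closed manifold `M` modelled on `ℝᵐ`, a Riemannian
reference metric `g₀` with density ratio `ρ(s, x) = dV_{h(s)}/dV_{g₀}(x)`, smooth coefficients
`Q, G` and an open set of times `T`, a function `v` which is `C^∞` on `M × T` and satisfies the
very weak equation
`∫ v (−∂ₛ(ρζ) − ρ Δ_{h(s)}ζ + ρ Q ζ) d(V_{g₀} ⊗ ds) = ∫ ρ G ζ d(V_{g₀} ⊗ ds)`
for all smooth compactly supported test functions `ζ` with `tsupport ζ ⊆ M × T`, satisfies the
equation `∂ₛv − Δ_{h(s)}v + Q v = G` pointwise on `M × T`: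

* `linearHeat_classical_of_veryWeak_of_contMDiffOn`.

The proof integrates by parts in time (fundamental theorem of calculus on `ℝ` for the compactly
supported `s ↦ v ρ ζ`) and in space (Green's first identity on `(M, h(s))`,
`integral_mul_laplaceBeltrami_eq_neg_integral_innerDual`, with `dV_{h(s)} = ρ dV_{g₀}`), and
concludes with the fundamental lemma of the calculus of variations for continuous functions on an
open subset of a manifold, with smooth bump functions as test functions
(`eqOn_zero_of_forall_integral_mul_contMDiff_eq_zero`).

Everything is proved; no definitions, no named facts.

## References

* L. C. Evans, *Partial differential equations*, 2nd ed., AMS (2010), §7.1.1 (motivation of the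
  weak formulation by integration by parts). [Evans2010]
* J. M. Lee, *Introduction to Riemannian manifolds*, 2nd ed. (2018), Problem 2-23 (a) (Green's
  identities). [Lee2018]
-/

noncomputable section

open Bundle Set Function Filter Manifold MeasureTheory Measure TopologicalSpace
open scoped Manifold ContDiff Topology ENNReal NNReal

namespace Literature.Geometry.Riemannian

open Lorentzian Lorentzian.PseudoRiemannianMetric

/-! ### Topological and variational lemmas -/

section General

variable {X : Type*} [TopologicalSpace X]

/-- A function continuous on an open set times a continuous function supported inside that set
is continuous on the whole space (a local copy of the lemma of the same name in
`ChartTestFunctions.lean`, to keep the imports of this file small). [folklore] -/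
private theorem continuous_mul_of_continuousOn_of_tsupport_subset' {O : Set X} (hO : IsOpen O)
    {E k : X → ℝ} (hE : ContinuousOn E O) (hk : Continuous k) (hkO : tsupport k ⊆ O) :
    Continuous fun p ↦ E p * k p := by
  refine continuous_of_tsupport fun p hp ↦ ?_
  have hpO : p ∈ O := hkO (tsupport_mul_subset_right hp)
  exact ((hE.continuousWithinAt hpO).continuousAt (hO.mem_nhds hpO)).mul hk.continuousAt

/-- Pulling back "vanishes near a point" along a slice map. [folklore] -/
theorem eventuallyEq_zero_comp_of_eventuallyEq_zero {Y : Type*} [TopologicalSpace Y]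
    {ζ : X → ℝ} {ι : Y → X} (hι : Continuous ι) {y : Y} (h : ζ =ᶠ[𝓝 (ι y)] 0) :
    (fun z ↦ ζ (ι z)) =ᶠ[𝓝 y] 0 :=
  hι.continuousAt.eventually h

variable {EX : Type*} [NormedAddCommGroup EX] [NormedSpace ℝ EX] [FiniteDimensional ℝ EX]
  {HX : Type*} [TopologicalSpace HX] {J : ModelWithCorners ℝ EX HX}
  [ChartedSpace HX X] [IsManifold J ∞ X] [T2Space X]
  [MeasurableSpace X] [BorelSpace X]

/-- **Fundamental lemma of the calculus of variations for continuous functions on an open subset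
of a manifold**, with nonnegative smooth compactly supported test functions (smooth bump
functions): if `E` is continuous on the open set `O` and `∫ E ζ dμ = 0` for every nonnegative
`C^∞` function `ζ` with compact support inside `O`, and `μ` is finite on compact sets and charges
open sets, then `E = 0` on `O`. [folklore] -/
theorem eqOn_zero_of_forall_integral_mul_contMDiff_eq_zero (μ : Measure X)
    [IsFiniteMeasureOnCompacts μ] [μ.IsOpenPosMeasure] {O : Set X} (hO : IsOpen O) {E : X → ℝ}
    (hE : ContinuousOn E O)
    (h : ∀ ζ : X → ℝ, ContMDiff J 𝓘(ℝ, ℝ) ∞ ζ → HasCompactSupport ζ → tsupport ζ ⊆ O →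
      (∀ p, 0 ≤ ζ p) → ∫ p, E p * ζ p ∂μ = 0) : ∀ p ∈ O, E p = 0 := by
  -- it suffices to exclude `0 < E p₀`
  suffices key : ∀ E : X → ℝ, ContinuousOn E O →
      (∀ ζ : X → ℝ, ContMDiff J 𝓘(ℝ, ℝ) ∞ ζ → HasCompactSupport ζ → tsupport ζ ⊆ O →
        (∀ p, 0 ≤ ζ p) → ∫ p, E p * ζ p ∂μ = 0) → ∀ p₀ ∈ O, ¬ 0 < E p₀ by
    intro p₀ hp₀
    rcases lt_trichotomy 0 (E p₀) with hlt | heq | hgt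
    · exact absurd hlt (key E hE h p₀ hp₀)
    · exact heq.symm
    · refine absurd (neg_pos.2 hgt) (key (fun p ↦ -E p) hE.neg (fun ζ h1 h2 h3 h4 ↦ ?_) p₀ hp₀)
      have e : (fun p ↦ -E p * ζ p) = fun p ↦ -(E p * ζ p) := by funext p; ring
      rw [e, integral_neg, h ζ h1 h2 h3 h4, neg_zero]
  intro E hE h p₀ hp₀ hpos
  set ε : ℝ := E p₀ / 2 with hε
  have hεpos : 0 < ε := by rw [hε]; linarith
  -- a neighbourhood of `p₀` inside `O` on which `E > ε`, and a bump function supported in it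
  set U : Set X := O ∩ E ⁻¹' Ioi ε with hU
  have hUo : IsOpen U := hE.isOpen_inter_preimage hO isOpen_Ioi
  have hp₀U : p₀ ∈ U := ⟨hp₀, by simp only [mem_preimage, mem_Ioi, hε]; linarith⟩
  obtain ⟨f, -, hfU⟩ := (SmoothBumpFunction.nhds_basis_tsupport (I := J) p₀).mem_iff.1
    (hUo.mem_nhds hp₀U)
  have hfO : tsupport f ⊆ O := hfU.trans inter_subset_left
  have hfc : Continuous (f : X → ℝ) := f.contMDiff.continuous
  have hfnn : ∀ p, 0 ≤ f p := fun p ↦ f.nonneg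
  have h0 := h f f.contMDiff f.hasCompactSupport hfO hfnn
  -- `∫ E f ≥ ε ∫ f > 0`
  have hEf : Continuous fun p ↦ E p * f p :=
    continuous_mul_of_continuousOn_of_tsupport_subset' hO hE hfc hfO
  have hEfint : Integrable (fun p ↦ E p * f p) μ :=
    hEf.integrable_of_hasCompactSupport f.hasCompactSupport.mul_left
  have hfint : Integrable (fun p ↦ (f p : ℝ)) μ :=
    hfc.integrable_of_hasCompactSupport f.hasCompactSupport
  have hfpos : 0 < ∫ p, f p ∂μ := by
    rw [integral_pos_iff_support_of_nonneg hfnn hfint]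
    refine hfc.isOpen_support.measure_pos μ ⟨p₀, ?_⟩
    rw [mem_support, f.eq_one]
    exact one_ne_zero
  have hge : ε * ∫ p, f p ∂μ ≤ ∫ p, E p * f p ∂μ := by
    rw [← MeasureTheory.integral_const_mul]
    refine integral_mono (hfint.const_mul ε) hEfint fun p ↦ ?_
    by_cases hp : f p = 0
    · simp [hp]
    · have hpU : p ∈ U := hfU (subset_tsupport _ hp)
      have : ε < E p := hpU.2
      exact mul_le_mul_of_nonneg_right this.le (hfnn p)
  have : 0 < ε * ∫ p, f p ∂μ := mul_pos hεpos hfpos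
  linarith

/-- **Integration by parts on `ℝ` against a compactly supported factor**: if `k` is `C¹` with
compact support inside an open set `T` on which `w` is differentiable with continuous derivative
(`w'` continuous on `T`, `HasDerivAt w (w' σ) σ` for `σ ∈ T`), then
`∫ w k' = −∫ w' k`. [folklore] -/
theorem integral_mul_deriv_eq_neg_of_tsupport_subset {T : Set ℝ} (hT : IsOpen T)
    {w w' k : ℝ → ℝ} (hw : ContinuousOn w T) (hw' : ContinuousOn w' T)
    (hwd : ∀ σ ∈ T, HasDerivAt w (w' σ) σ) (hk : ContDiff ℝ 1 k) (hkc : HasCompactSupport k)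
    (hkT : tsupport k ⊆ T) :
    ∫ σ, w σ * deriv k σ = -∫ σ, w' σ * k σ := by
  have hkd : ∀ σ, HasDerivAt k (deriv k σ) σ := fun σ ↦
    (hk.differentiable (by simp) σ).hasDerivAt
  have hk'c : Continuous (deriv k) := hk.continuous_deriv le_rfl
  have hk'T : tsupport (deriv k) ⊆ T := tsupport_deriv_subset.trans hkT
  have hk'cs : HasCompactSupport (deriv k) := hkc.deriv
  -- the product `w k` and its derivative
  have hzero : ∀ σ, σ ∉ T → k =ᶠ[𝓝 σ] 0 := fun σ hσ ↦
    notMem_tsupport_iff_eventuallyEq.1 fun hm ↦ hσ (hkT hm)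
  have hprod : ∀ σ, HasDerivAt (fun s ↦ w s * k s) (w' σ * k σ + w σ * deriv k σ) σ := by
    intro σ
    by_cases hσ : σ ∈ T
    · exact (hwd σ hσ).mul (hkd σ)
    · have h1 : (fun s ↦ w s * k s) =ᶠ[𝓝 σ] fun _ ↦ (0 : ℝ) := by
        filter_upwards [hzero σ hσ] with s hs
        rw [hs, Pi.zero_apply, mul_zero]
      have hk0 : k σ = 0 := (hzero σ hσ).self_of_nhds
      have hdk0 : deriv k σ = 0 := by
        rw [(hzero σ hσ).deriv_eq]; exact deriv_const σ 0
      rw [hk0, hdk0, mul_zero, mul_zero, add_zero]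
      exact (hasDerivAt_const σ (0 : ℝ)).congr_of_eventuallyEq h1
  have hi1 : Integrable fun σ ↦ w' σ * k σ :=
    (continuous_mul_of_continuousOn_of_tsupport_subset' hT hw' hk.continuous hkT)
      |>.integrable_of_hasCompactSupport hkc.mul_left
  have hi2 : Integrable fun σ ↦ w σ * deriv k σ :=
    (continuous_mul_of_continuousOn_of_tsupport_subset' hT hw hk'c hk'T)
      |>.integrable_of_hasCompactSupport hk'cs.mul_left
  -- `w k → 0` at `±∞` (compact support)
  obtain ⟨A, hA⟩ : ∃ A : ℝ, ∀ σ, A < |σ| → w σ * k σ = 0 := by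
    obtain ⟨A, hA⟩ := (hkc.isCompact.isBounded).subset_closedBall 0
    refine ⟨A, fun σ hσ ↦ ?_⟩
    have : σ ∉ tsupport k := fun hm ↦ by
      have := hA hm
      rw [Metric.mem_closedBall, dist_zero_right, Real.norm_eq_abs] at this
      linarith
    rw [image_eq_zero_of_notMem_tsupport this, mul_zero]
  have htop : Tendsto (fun s ↦ w s * k s) atTop (𝓝 0) := by
    refine tendsto_const_nhds.congr' ?_
    filter_upwards [eventually_gt_atTop |A|] with σ hσ
    exact (hA σ (lt_of_le_of_lt (le_abs_self A) (hσ.trans_le (le_abs_self σ)))).symm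
  have hbot : Tendsto (fun s ↦ w s * k s) atBot (𝓝 0) := by
    refine tendsto_const_nhds.congr' ?_
    filter_upwards [eventually_lt_atBot (-|A|)] with σ hσ
    refine (hA σ ?_).symm
    have : |A| < -σ := by linarith
    exact lt_of_le_of_lt (le_abs_self A) (this.trans_le (neg_le_abs σ))
  have hftc := integral_of_hasDerivAt_of_tendsto hprod (hi1.add hi2) hbot htop
  rw [sub_zero, integral_add hi1 hi2] at hftc
  linarith

end General

/-! ### Smooth very weak solutions are classical -/

section Classical

variable {m : ℕ} {H : Type*} [TopologicalSpace H]
  {I : ModelWithCorners ℝ (EuclideanSpace ℝ (Fin m)) H} [I.Boundaryless]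
  {M : Type*} [TopologicalSpace M] [ChartedSpace H M] [IsManifold I ∞ M]
  [T2Space M] [CompactSpace M] [SecondCountableTopology M] [MeasurableSpace M] [BorelSpace M]
  {h : ℝ → PseudoRiemannianMetric I ∞ (EuclideanSpace ℝ (Fin m)) (TangentSpace I : M → Type _)}
  {g₀ : PseudoRiemannianMetric I ∞ (EuclideanSpace ℝ (Fin m)) (TangentSpace I : M → Type _)}

omit [I.Boundaryless] [T2Space M] [CompactSpace M] [SecondCountableTopology M] [MeasurableSpace M]
  [BorelSpace M] in
/-- Locality of the Laplace–Beltrami operator: `Δ_g f (x) = 0` if `f` vanishes near `x`.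
[folklore] -/
theorem laplaceBeltrami_eq_zero_of_eventuallyEq_zero
    (g : PseudoRiemannianMetric I ∞ (EuclideanSpace ℝ (Fin m)) (TangentSpace I : M → Type _))
    {f : M → ℝ} {x : M} (hf : f =ᶠ[𝓝 x] fun _ ↦ 0) : g.laplaceBeltrami f x = 0 := by
  haveI := g.hasLeviCivita
  rw [laplaceBeltrami_eq_dalembertian]
  exact g.dalembertian_eq_zero_of_eventuallyEq_zero hf

omit [I.Boundaryless] [IsManifold I ∞ M] [T2Space M] [CompactSpace M] [SecondCountableTopology M]
  [MeasurableSpace M] [BorelSpace M] in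
/-- The time slice at `y` of a compactly supported function on `M × ℝ` has compact support, with
closed support inside every open time set containing the time support. [folklore] -/
theorem hasCompactSupport_slice_time {k : M × ℝ → ℝ} (hkc : HasCompactSupport k) (y : M)
    {T : Set ℝ} (hkT : tsupport k ⊆ univ ×ˢ T) :
    HasCompactSupport (fun s ↦ k (y, s)) ∧ tsupport (fun s ↦ k (y, s)) ⊆ T := by
  have hC : IsClosed ((fun s : ℝ ↦ ((y, s) : M × ℝ)) ⁻¹' tsupport k) :=
    (isClosed_tsupport k).preimage (continuous_const.prodMk continuous_id)
  have hsub : support (fun s ↦ k (y, s)) ⊆ (fun s : ℝ ↦ ((y, s) : M × ℝ)) ⁻¹' tsupport k :=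
    fun s hs ↦ subset_tsupport _ hs
  refine ⟨HasCompactSupport.of_support_subset_isCompact (hkc.isCompact.image continuous_snd)
    fun s hs ↦ ⟨(y, s), subset_tsupport _ hs, rfl⟩, ?_⟩
  exact (closure_minimal hsub hC).trans fun s hs ↦ (hkT hs).2

/-- **Smooth very weak solutions of `∂ₛv − Δ_{h(s)}v + Q v = G` are classical solutions.** In the
setting of `exists_contMDiffOn_ae_eq_of_linearHeat_veryWeak` (a `C^∞` family of Riemannian
metrics `h` on a closed manifold modelled on `ℝᵐ`, a Riemannian reference metric `g₀` with density
ratio `ρ = dV_{h(s)}/dV_{g₀}`, smooth `Q, G`, an open time set `T`): if `v` is `C^∞` on `M × T`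
and `∫ v (−∂ₛ(ρζ) − ρΔ_{h(s)}ζ + ρQζ) d(V_{g₀} ⊗ ds) = ∫ ρ G ζ d(V_{g₀} ⊗ ds)` for all smooth
compactly supported `ζ` with `tsupport ζ ⊆ M × T`, then
`∂ₛv − Δ_{h(s)}v + Q v = G` on `M × T` (integration by parts in time, Green's identity in space,
and the fundamental lemma of the calculus of variations). [cite: Evans2010, §7.1.1] -/
theorem linearHeat_classical_of_veryWeak_of_contMDiffOn
    (hh : IsContMDiffFamilyOn ∞ h univ) (hR : ∀ s, (h s).IsRiemannian) (hR₀ : g₀.IsRiemannian)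
    {Q G : ℝ → M → ℝ} (hQ : ContMDiff (I.prod 𝓘(ℝ, ℝ)) 𝓘(ℝ, ℝ) ∞ fun p : M × ℝ ↦ Q p.2 p.1)
    (hG : ContMDiff (I.prod 𝓘(ℝ, ℝ)) 𝓘(ℝ, ℝ) ∞ fun p : M × ℝ ↦ G p.2 p.1)
    {T : Set ℝ} (hT : IsOpen T) {v : M × ℝ → ℝ}
    (hv : ContMDiffOn (I.prod 𝓘(ℝ, ℝ)) 𝓘(ℝ, ℝ) ∞ v (univ ×ˢ T))
    (hweak : ∀ ζ : M × ℝ → ℝ, ContMDiff (I.prod 𝓘(ℝ, ℝ)) 𝓘(ℝ, ℝ) ∞ ζ → HasCompactSupport ζ →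
      tsupport ζ ⊆ univ ×ˢ T →
      ∫ p, v p * (-(deriv (fun s ↦ (h s).densityRatio g₀ p.1 * ζ (p.1, s)) p.2) -
          (h p.2).densityRatio g₀ p.1 * (h p.2).laplaceBeltrami (fun x ↦ ζ (x, p.2)) p.1 +
          (h p.2).densityRatio g₀ p.1 * Q p.2 p.1 * ζ p) ∂g₀.riemVolume.prod (volume : Measure ℝ) =
        ∫ p, (h p.2).densityRatio g₀ p.1 * G p.2 p.1 * ζ p
          ∂g₀.riemVolume.prod (volume : Measure ℝ)) :
    ∀ p ∈ univ ×ˢ T, deriv (fun s ↦ v (p.1, s)) p.2 -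
      (h p.2).laplaceBeltrami (fun x ↦ v (x, p.2)) p.1 + Q p.2 p.1 * v p = G p.2 p.1 := by
  classical
  have h1le : (1 : ℕ∞ω) ≤ (∞ : ℕ∞ω) := WithTop.coe_le_coe.mpr le_top
  have h2le : (2 : ℕ∞ω) ≤ (∞ : ℕ∞ω) := WithTop.coe_le_coe.mpr le_top
  -- the reference measure
  set μ₀ : Measure M := g₀.riemVolume with hμ₀
  haveI : IsFiniteMeasure μ₀ := ⟨by rw [hμ₀]; exact g₀.riemVolume_univ_lt_top⟩
  haveI : μ₀.IsOpenPosMeasure := by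
    rw [hμ₀, PseudoRiemannianMetric.riemVolume_eq hR₀]
    exact isOpenPosMeasure_riemannianMeasure _
  haveI : (μ₀.prod (volume : Measure ℝ)).IsOpenPosMeasure := prod.instIsOpenPosMeasure
  have hO : IsOpen ((univ : Set M) ×ˢ T) := isOpen_univ.prod hT
  -- the density ratio
  set ρ : ℝ → M → ℝ := fun s y ↦ (h s).densityRatio g₀ y with hρ
  have hρpos : ∀ s y, 0 < ρ s y := fun s y ↦ densityRatio_pos (hR _) hR₀ y
  have hρs : ContMDiff (I.prod 𝓘(ℝ, ℝ)) 𝓘(ℝ, ℝ) ∞ (fun p : M × ℝ ↦ ρ p.2 p.1) := by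
    have h1 := hh.contMDiffOn_densityRatio (g₀ := g₀) (fun s _ ↦ hR s) hR₀
    rwa [univ_prod_univ, contMDiffOn_univ] at h1
  have hρc : Continuous fun p : M × ℝ ↦ ρ p.2 p.1 := hρs.continuous
  -- continuity data of `v`: `v`, `∂ₛv`, `Δv` on `M × T`; slices
  have hvc : ContinuousOn v (univ ×ˢ T) := hv.continuousOn
  have hDv : ContinuousOn (fun p : M × ℝ ↦ deriv (fun s ↦ v (p.1, s)) p.2) (univ ×ˢ T) := by
    have h1 := Literature.Geometry.Manifold.contMDiffOn_derivWithin_time (I := I)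
      (u := fun s x ↦ v (x, s)) hT.uniqueDiffOn hv
    refine h1.continuousOn.congr fun p hp ↦ ?_
    simp only
    rw [derivWithin_of_isOpen hT hp.2]
  have hLv : ContinuousOn (fun p : M × ℝ ↦ (h p.2).laplaceBeltrami (fun x ↦ v (x, p.2)) p.1)
      (univ ×ˢ T) :=
    ((hh.mono (subset_univ T)).contMDiffOn_laplaceBeltrami hT.uniqueDiffOn
      (f := fun s x ↦ v (x, s)) hv).continuousOn
  have hvslice : ∀ σ ∈ T, ContMDiff I 𝓘(ℝ, ℝ) ∞ fun x ↦ v (x, σ) := fun σ hσ ↦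
    hv.comp_contMDiff (contMDiff_id.prodMk contMDiff_const) fun x ↦ ⟨mem_univ _, hσ⟩
  have hvderiv : ∀ y, ∀ σ ∈ T, HasDerivAt (fun s ↦ v (y, s)) (deriv (fun s ↦ v (y, s)) σ) σ := by
    intro y σ hσ
    have h1 : ContMDiffAt (I.prod 𝓘(ℝ, ℝ)) 𝓘(ℝ, ℝ) ∞ v (y, σ) :=
      (hv _ ⟨mem_univ _, hσ⟩).contMDiffAt (hO.mem_nhds ⟨mem_univ _, hσ⟩)
    have h2 : ContMDiffAt 𝓘(ℝ, ℝ) 𝓘(ℝ, ℝ) ∞ (fun s ↦ v (y, s)) σ :=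
      h1.comp σ (contMDiffAt_const.prodMk contMDiffAt_id)
    exact (h2.contDiffAt.differentiableAt (by simp)).hasDerivAt
  -- the continuous function which will be shown to vanish
  set W : M × ℝ → ℝ := fun p ↦ (deriv (fun s ↦ v (p.1, s)) p.2 -
    (h p.2).laplaceBeltrami (fun x ↦ v (x, p.2)) p.1 + Q p.2 p.1 * v p - G p.2 p.1) * ρ p.2 p.1
    with hW
  have hWc : ContinuousOn W (univ ×ˢ T) :=
    (((hDv.sub hLv).add (hQ.continuous.continuousOn.mul hvc)).sub
      hG.continuous.continuousOn).mul hρc.continuousOn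
  suffices hW0 : ∀ p ∈ univ ×ˢ T, W p = 0 by
    intro p hp
    have h1 := hW0 p hp
    rw [hW] at h1
    simp only at h1
    have h2 := (mul_eq_zero.1 h1).resolve_right (hρpos _ _).ne'
    linarith
  refine eqOn_zero_of_forall_integral_mul_contMDiff_eq_zero (J := I.prod 𝓘(ℝ, ℝ))
    (μ₀.prod (volume : Measure ℝ)) hO hWc fun ζ hζ hζc hζT _ ↦ ?_
  /- the identity `∫ W ζ = 0` for a test function `ζ` -/
  have hζc' : Continuous ζ := hζ.continuous
  have hζslice : ∀ σ, ContMDiff I 𝓘(ℝ, ℝ) ∞ fun x ↦ ζ (x, σ) := fun σ ↦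
    hζ.comp (contMDiff_id.prodMk contMDiff_const)
  have hζzero : ∀ p, p ∉ tsupport ζ → ζ =ᶠ[𝓝 p] 0 := fun p hp ↦
    notMem_tsupport_iff_eventuallyEq.1 hp
  have hζT' : ∀ σ, σ ∉ T → ∀ y, ζ (y, σ) = 0 := fun σ hσ y ↦
    image_eq_zero_of_notMem_tsupport fun hm ↦ hσ (hζT hm).2
  -- `ρ ζ` and its time derivative `kt`, the space term `kx`
  have hρζs : ContMDiff (I.prod 𝓘(ℝ, ℝ)) 𝓘(ℝ, ℝ) ∞ (fun p : M × ℝ ↦ ρ p.2 p.1 * ζ p) :=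
    hρs.mul hζ
  have hρζsupp : tsupport (fun p : M × ℝ ↦ ρ p.2 p.1 * ζ p) ⊆ univ ×ˢ T :=
    (tsupport_mul_subset_right).trans hζT
  set kt : M × ℝ → ℝ := fun p ↦ deriv (fun s ↦ ρ s p.1 * ζ (p.1, s)) p.2 with hkt
  have hktc : Continuous kt :=
    (Literature.Geometry.Manifold.contMDiff_deriv_time (I := I)
      (u := fun s y ↦ ρ s y * ζ (y, s)) hρζs).continuous
  have hktsupp : support kt ⊆ tsupport ζ := by
    intro p hp
    by_contra hnot
    have e0 : (fun s ↦ ρ s p.1 * ζ (p.1, s)) =ᶠ[𝓝 p.2] fun _ ↦ (0 : ℝ) := by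
      have e1 := eventuallyEq_zero_comp_of_eventuallyEq_zero (ι := fun s : ℝ ↦ ((p.1, s) : M × ℝ))
        (continuous_const.prodMk continuous_id) (y := p.2) (hζzero p hnot)
      filter_upwards [e1] with s hs
      simp only [Pi.zero_apply] at hs
      rw [hs, mul_zero]
    refine hp ?_
    rw [hkt]
    simp only
    rw [e0.deriv_eq]
    exact deriv_const p.2 0
  have hktT : tsupport kt ⊆ univ ×ˢ T :=
    (closure_minimal hktsupp (isClosed_tsupport ζ)).trans hζT
  have hktcs : HasCompactSupport kt := hζc.mono' hktsupp
  set kx : M × ℝ → ℝ := fun p ↦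
    ρ p.2 p.1 * (h p.2).laplaceBeltrami (fun x ↦ ζ (x, p.2)) p.1 with hkx
  have hkxc : Continuous kx := by
    have h2 := hh.contMDiffOn_laplaceBeltrami uniqueDiffOn_univ (f := fun s x ↦ ζ (x, s))
      (by rw [univ_prod_univ]; exact hζ.contMDiffOn)
    rw [univ_prod_univ] at h2
    exact hρc.mul (contMDiffOn_univ.1 h2).continuous
  have hkxsupp : support kx ⊆ tsupport ζ := by
    intro p hp
    by_contra hnot
    have e0 : (fun x ↦ ζ (x, p.2)) =ᶠ[𝓝 p.1] fun _ ↦ (0 : ℝ) :=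
      eventuallyEq_zero_comp_of_eventuallyEq_zero (ι := fun x : M ↦ ((x, p.2) : M × ℝ))
        (continuous_id.prodMk continuous_const) (y := p.1) (hζzero p hnot)
    refine hp ?_
    rw [hkx]
    simp only
    rw [laplaceBeltrami_eq_zero_of_eventuallyEq_zero _ e0, mul_zero]
  have hkxT : tsupport kx ⊆ univ ×ˢ T :=
    (closure_minimal hkxsupp (isClosed_tsupport ζ)).trans hζT
  have hkxcs : HasCompactSupport kx := hζc.mono' hkxsupp
  -- integrability of the five space-time integrands
  have hI1 : Integrable (fun p ↦ v p * kt p) (μ₀.prod (volume : Measure ℝ)) :=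
    (continuous_mul_of_continuousOn_of_tsupport_subset' hO hvc hktc hktT)
      |>.integrable_of_hasCompactSupport hktcs.mul_left
  have hI2 : Integrable (fun p : M × ℝ ↦ deriv (fun s ↦ v (p.1, s)) p.2 * (ρ p.2 p.1 * ζ p))
      (μ₀.prod (volume : Measure ℝ)) :=
    (continuous_mul_of_continuousOn_of_tsupport_subset' hO hDv hρζs.continuous hρζsupp)
      |>.integrable_of_hasCompactSupport (hζc.mul_left).mul_left
  have hI3 : Integrable (fun p ↦ v p * kx p) (μ₀.prod (volume : Measure ℝ)) :=
    (continuous_mul_of_continuousOn_of_tsupport_subset' hO hvc hkxc hkxT)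
      |>.integrable_of_hasCompactSupport hkxcs.mul_left
  have hI4 : Integrable (fun p : M × ℝ ↦
      (h p.2).laplaceBeltrami (fun x ↦ v (x, p.2)) p.1 * (ρ p.2 p.1 * ζ p))
      (μ₀.prod (volume : Measure ℝ)) :=
    (continuous_mul_of_continuousOn_of_tsupport_subset' hO hLv hρζs.continuous hρζsupp)
      |>.integrable_of_hasCompactSupport (hζc.mul_left).mul_left
  have hI5 : Integrable (fun p : M × ℝ ↦ v p * (ρ p.2 p.1 * Q p.2 p.1 * ζ p))
      (μ₀.prod (volume : Measure ℝ)) := by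
    have hs : tsupport (fun p : M × ℝ ↦ ρ p.2 p.1 * Q p.2 p.1 * ζ p) ⊆ univ ×ˢ T :=
      (tsupport_mul_subset_right).trans hζT
    exact (continuous_mul_of_continuousOn_of_tsupport_subset' hO hvc
      ((hρc.mul hQ.continuous).mul hζc') hs).integrable_of_hasCompactSupport
        (hζc.mul_left).mul_left
  have hI6 : Integrable (fun p : M × ℝ ↦ G p.2 p.1 * (ρ p.2 p.1 * ζ p))
      (μ₀.prod (volume : Measure ℝ)) :=
    ((hG.continuous.mul hρζs.continuous).integrable_of_hasCompactSupport
      (hζc.mul_left).mul_left)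
  -- (I-t) integration by parts in time
  have hIt : ∫ p, v p * kt p ∂μ₀.prod (volume : Measure ℝ) =
      -∫ p : M × ℝ, deriv (fun s ↦ v (p.1, s)) p.2 * (ρ p.2 p.1 * ζ p)
        ∂μ₀.prod (volume : Measure ℝ) := by
    rw [integral_prod _ hI1, integral_prod _ hI2, ← integral_neg]
    refine integral_congr_ae (Eventually.of_forall fun y ↦ ?_)
    simp only
    obtain ⟨hkyc, hkyT⟩ := hasCompactSupport_slice_time (k := fun p : M × ℝ ↦ ρ p.2 p.1 * ζ p)
      (hζc.mul_left) y hρζsupp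
    have hky : ContDiff ℝ 1 fun s ↦ ρ s y * ζ (y, s) :=
      ((hρζs.comp (contMDiff_const.prodMk contMDiff_id)).contDiff).of_le h1le
    have hwc : ContinuousOn (fun s ↦ v (y, s)) T :=
      hvc.comp (continuous_const.prodMk continuous_id).continuousOn fun s hs ↦ ⟨mem_univ _, hs⟩
    have hw'c : ContinuousOn (fun s ↦ deriv (fun s' ↦ v (y, s')) s) T :=
      hDv.comp (continuous_const.prodMk continuous_id).continuousOn fun s hs ↦ ⟨mem_univ _, hs⟩
    exact integral_mul_deriv_eq_neg_of_tsupport_subset hT hwc hw'c (hvderiv y) hky hkyc hkyT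
  -- (I-x) Green's identity in space
  have hIx : ∫ p, v p * kx p ∂μ₀.prod (volume : Measure ℝ) =
      ∫ p : M × ℝ, (h p.2).laplaceBeltrami (fun x ↦ v (x, p.2)) p.1 * (ρ p.2 p.1 * ζ p)
        ∂μ₀.prod (volume : Measure ℝ) := by
    rw [integral_prod_symm _ hI3, integral_prod_symm _ hI4]
    refine integral_congr_ae (Eventually.of_forall fun σ ↦ ?_)
    simp only
    by_cases hσ : σ ∈ T
    · -- Green twice on `(M, h σ)`, `dV_{h σ} = ρ dV_{g₀}`
      have hvσ := hvslice σ hσ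
      have hζσ := hζslice σ
      have e1 : ∫ y, v (y, σ) * kx (y, σ) ∂μ₀ =
          ∫ y, v (y, σ) * (h σ).laplaceBeltrami (fun x ↦ ζ (x, σ)) y ∂(h σ).riemVolume := by
        rw [integral_riemVolume_eq_integral_mul_densityRatio (hR σ) hR₀]
        refine integral_congr_ae (Eventually.of_forall fun y ↦ ?_)
        rw [hkx]
        simp only
        ring
      have e2 : ∫ y, (h σ).laplaceBeltrami (fun x ↦ v (x, σ)) y * (ρ σ y * ζ (y, σ)) ∂μ₀ =
          ∫ y, ζ (y, σ) * (h σ).laplaceBeltrami (fun x ↦ v (x, σ)) y ∂(h σ).riemVolume := by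
        rw [integral_riemVolume_eq_integral_mul_densityRatio (hR σ) hR₀]
        refine integral_congr_ae (Eventually.of_forall fun y ↦ ?_)
        simp only
        ring
      rw [e1, e2, integral_mul_laplaceBeltrami_eq_neg_integral_innerDual (hR σ) (hvσ.of_le h1le)
        (hζσ.of_le h2le), integral_mul_laplaceBeltrami_eq_neg_integral_innerDual (hR σ)
        (hζσ.of_le h1le) (hvσ.of_le h2le)]
      congr 1
      refine integral_congr_ae (Eventually.of_forall fun y ↦ ?_)
      exact innerDual_comm _ _ _ _
    · -- the slice of `ζ` vanishes
      have hz : (fun x ↦ ζ (x, σ)) = fun _ ↦ (0 : ℝ) := funext fun y ↦ hζT' σ hσ y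
      refine integral_congr_ae (Eventually.of_forall fun y ↦ ?_)
      rw [hkx]
      simp only
      rw [hz, laplaceBeltrami_fun_zero, hζT' σ hσ y]
      ring
  -- assemble
  have hw := hweak ζ hζ hζc hζT
  have hlhs : ∫ p, v p * (-(deriv (fun s ↦ (h s).densityRatio g₀ p.1 * ζ (p.1, s)) p.2) -
      (h p.2).densityRatio g₀ p.1 * (h p.2).laplaceBeltrami (fun x ↦ ζ (x, p.2)) p.1 +
      (h p.2).densityRatio g₀ p.1 * Q p.2 p.1 * ζ p) ∂μ₀.prod (volume : Measure ℝ) =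
      -∫ p, v p * kt p ∂μ₀.prod (volume : Measure ℝ) - ∫ p, v p * kx p ∂μ₀.prod (volume : Measure ℝ)
        + ∫ p : M × ℝ, v p * (ρ p.2 p.1 * Q p.2 p.1 * ζ p) ∂μ₀.prod (volume : Measure ℝ) := by
    have e1 : ∫ p, v p * (-(deriv (fun s ↦ (h s).densityRatio g₀ p.1 * ζ (p.1, s)) p.2) -
        (h p.2).densityRatio g₀ p.1 * (h p.2).laplaceBeltrami (fun x ↦ ζ (x, p.2)) p.1 +
        (h p.2).densityRatio g₀ p.1 * Q p.2 p.1 * ζ p) ∂μ₀.prod (volume : Measure ℝ) =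
        ∫ p : M × ℝ, ((-(v p * kt p) - v p * kx p) + v p * (ρ p.2 p.1 * Q p.2 p.1 * ζ p))
          ∂μ₀.prod (volume : Measure ℝ) := by
      refine integral_congr_ae (Eventually.of_forall fun p ↦ ?_)
      rw [hkt, hkx]
      simp only
      ring
    have hA : Integrable (fun p : M × ℝ ↦ -(v p * kt p) - v p * kx p)
        (μ₀.prod (volume : Measure ℝ)) := hI1.fun_neg.sub hI3
    have hB : Integrable (fun p : M × ℝ ↦ -(v p * kt p)) (μ₀.prod (volume : Measure ℝ)) :=
      hI1.fun_neg
    rw [e1, integral_add hA hI5, integral_sub hB hI3, integral_neg]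
  have hrhs : ∫ p, (h p.2).densityRatio g₀ p.1 * G p.2 p.1 * ζ p ∂μ₀.prod (volume : Measure ℝ) =
      ∫ p : M × ℝ, G p.2 p.1 * (ρ p.2 p.1 * ζ p) ∂μ₀.prod (volume : Measure ℝ) := by
    refine integral_congr_ae (Eventually.of_forall fun p ↦ ?_)
    simp only
    ring
  rw [hlhs, hrhs, hIt, hIx, neg_neg] at hw
  -- `∫ W ζ = (∫ ∂v ρζ) - (∫ Δv ρζ) + (∫ v ρ Q ζ) - ∫ G ρ ζ = 0`
  have hWζ : ∫ p, W p * ζ p ∂μ₀.prod (volume : Measure ℝ) =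
      ∫ p : M × ℝ, deriv (fun s ↦ v (p.1, s)) p.2 * (ρ p.2 p.1 * ζ p) ∂μ₀.prod (volume : Measure ℝ)
      - ∫ p : M × ℝ, (h p.2).laplaceBeltrami (fun x ↦ v (x, p.2)) p.1 * (ρ p.2 p.1 * ζ p)
          ∂μ₀.prod (volume : Measure ℝ)
      + ∫ p : M × ℝ, v p * (ρ p.2 p.1 * Q p.2 p.1 * ζ p) ∂μ₀.prod (volume : Measure ℝ)
      - ∫ p : M × ℝ, G p.2 p.1 * (ρ p.2 p.1 * ζ p) ∂μ₀.prod (volume : Measure ℝ) := by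
    have e2 : ∫ p, W p * ζ p ∂μ₀.prod (volume : Measure ℝ) =
        ∫ p : M × ℝ, (((deriv (fun s ↦ v (p.1, s)) p.2 * (ρ p.2 p.1 * ζ p)
          - (h p.2).laplaceBeltrami (fun x ↦ v (x, p.2)) p.1 * (ρ p.2 p.1 * ζ p))
          + v p * (ρ p.2 p.1 * Q p.2 p.1 * ζ p)) - G p.2 p.1 * (ρ p.2 p.1 * ζ p))
          ∂μ₀.prod (volume : Measure ℝ) := by
      refine integral_congr_ae (Eventually.of_forall fun p ↦ ?_)
      rw [hW]
      simp only
      ring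
    have hA : Integrable (fun p : M × ℝ ↦ deriv (fun s ↦ v (p.1, s)) p.2 * (ρ p.2 p.1 * ζ p)
        - (h p.2).laplaceBeltrami (fun x ↦ v (x, p.2)) p.1 * (ρ p.2 p.1 * ζ p))
        (μ₀.prod (volume : Measure ℝ)) := hI2.sub hI4
    have hB : Integrable (fun p : M × ℝ ↦ (deriv (fun s ↦ v (p.1, s)) p.2 * (ρ p.2 p.1 * ζ p)
        - (h p.2).laplaceBeltrami (fun x ↦ v (x, p.2)) p.1 * (ρ p.2 p.1 * ζ p))
        + v p * (ρ p.2 p.1 * Q p.2 p.1 * ζ p)) (μ₀.prod (volume : Measure ℝ)) := hA.add hI5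
    rw [e2, integral_sub hB hI6, integral_add hA hI5, integral_sub hI2 hI4]
  rw [hWζ]
  linarith [hw]

end Classical

end Literature.Geometry.Riemannian

end
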